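import Summits.QuantumFields.BalabanUV.Beta.FP.TorusCompositeInsertionPeriodicSym
import Summits.QuantumFields.BalabanUV.Beta.FP.TorusCompositeCovarianceTwoPolarSym
import Summits.QuantumFields.BalabanUV.Beta.FP.TorusStepInsertionSymTwoStep

/-!
# `BalabanUV.Beta.FP.TorusCompositeInsertionPeriodicTwoSym` — road «FP» for binder row D1, ROUTE T, (β1) «sym» column: **THE SYM COMPOSITE SECOND-ORDER INSERTION
# BI-JET `compIns₂₂Sym … n h h′` ACTS ON PERIODIC 1-FORMS AS ANY LATTICE BI-FUNCTIONAL OBEYING OUR SYM SECOND CHAIN RULE** (the (β1) twin of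
# `TorusCompositeInsertionPeriodicTwo`), typed against GENERIC families `𝓡` (sym rows), `𝓘₁` (order 1, `TorusCompositeInsertionPeriodicSym`'s letters) and `𝓘₂` (order 2)

WHY.  `compIns₂₂Sym Lc M lev rs n h h′` (`TorusCompositeCovarianceTwoPolarSym`, OUR polarised ♭ sym second chain rule `compIns₂₂Sym_succ`) peels at the top into THREE
summands: the top step's sym bi-jet `stepIns₂₂Sym` along the two TRANSPORTED directions `compRowsSym′ *ᵥ h`, `compRowsSym′ *ᵥ h′` composed with the lower sym rows; the top
step's sym jet `stepIns₁Sym` along one transported direction composed with the lower sym composite jet `compIns₁Sym` along the other (both orders); the top sym rows `QstepSym`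
on the lower bi-jet.  Acting on a finest-periodic form, `TorusStepInsertionSymTwoStep.sum_stepIns₂₂Sym_mul_periodic` (bi-jet ↦ an1's symmetrised `symVh2KerAt (ctr (d+1) Lc)`
at the two lifts), `TorusStepInsertionSym.sum_stepIns₁Sym_mul_periodic` with `TorusCompositeInsertionPeriodicSym.sum_compIns₁Sym_mul_periodic` (the mixed summands), and
`TorusCompositeRowsSymPeriodic.sum_QstepSym_mul_periodic` (the lower summand) turn it into a recursion of LATTICE forms.  THIS FILE proves, for ANY rows functional `𝓡`
with the sym one-step clauses `hR0 ∕ hRsucc ∕ hRper`, ANY `𝓘₁` with the order-1 letters `h0₁ ∕ hsucc₁ ∕ hper₁` and ANY `𝓘₂` with `𝓘₂ … 0 = 0`, the displayed successor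
clause (`hsucc₂`, OUR recursion verbatim) and top-periodicity (`hper₂`):
`Σ_q compIns₂₂Sym Lc M lev rs n h h′ (x,κ₀) q · B q.2 q.1 = 𝓘₂ lev n (lift h) (lift h′) B κ₀ x`, at EVERY root list `rs`.  No lattice object is DEFINED here.

WHAT.  §1 **`sum_compIns₂₂Sym_mul_periodic`**.  §2 the letter `hper₂` FOLLOWS from the clauses: `symVh2KerAt_form_translate` (an1's `symVh2KerAt_add`), `periodic_of_clauses₂`
(so §1 is available from the clauses `hR0 ∕ hRsucc ∕ h0₁ ∕ hsucc₁ ∕ h0₂ ∕ hsucc₂` alone: pass `rows_periodic_of_clauses`, `periodic_of_clauses` and `periodic_of_clauses₂` of the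
order-1 file ∕ this file as the three letters).  NOT HERE: the row's carriers ∕ bridges; kernel-level packaging (next file); estimates.

[folklore] finite sums BY NAME over OUR bookkeeping objects (`compIns₂₂Sym ∕ compIns₁Sym ∕ stepIns₂₂Sym ∕ stepIns₁Sym ∕ compRowsSym ∕ QstepSym ∕ towerTorus`) and an1's typed
lattice kernels (`symLinKerAt`, `symVhKerAt`, `symVh2KerAt`); no `def`, no `def … : Prop`, nothing cited, 0 sorry; NO chart; nothing of Bałaban's asserted (that the
composite's second variation IS this chain is an2's (C1) TABLE word).
HONEST DEPENDENCY (page 1, mandatory): continuum YM on T⁴ ⇐ BetaPertH ∧ nine spine estimates (0/9 proved); BetaPertH ⇐ (D1) ∧ (D4) ∧ CAP+tail;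
G-an2-4 gates asym, D1 and NE2/3/4.  HONEST FRAMING (cell contract, verbatim): «discharging `BetaPertH` makes Bałaban's UV stability UNCONDITIONAL —
a real constructive-QFT result; it is NOT the continuum limit and NOT the Clay problem.»  ABSOLUTE RULE (cell charter, verbatim): «No internally-minted
statement may enter as a cited fact. Every hypothesis is either kernel-proved in this package or a verbatim quotation of a PUBLISHED theorem with page
reference. The manuscript(s) under audit are NOT citable for their own disputed steps — they are the thing under adjudication; programme-internal
(2001/route/tribunal) claims are never citable.»  0 estimates; 0∕4 row-D1 binders (hW, hR, D1Tel, D1Rep); NOT (T-ID), NOT (C1), NOT SDF, NOT D1,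
NOT BetaPertH, NOT continuum, NOT Clay.  D1 formalisation swarm LEAF PROVER 02 (b2b-balaban-beta-d1-formalise-leaf-02 gen 32), 2026-08-24.  No existing file touched.
v1.1 (leaf-02 g33, 2026-08-25): `lift_periodic ∕ periodic_apply_wrap` opened from the rooted R-7 `TorusCompositeInsertionPeriodic` (R-28 v1.1 no longer re-types them); every declaration byte-identical to v1 ad2ddf19469faaad.
-/

noncomputable section

open scoped BigOperators

namespace Summit.QuantumFields.BalabanUV.Beta.FP.TorusCompositeInsertionPeriodicTwoSym

open Matrix Finset
open Literature.MathematicalPhysics.QuantumFieldTheory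
open Literature.MathematicalPhysics.QuantumFieldTheory.Balaban1983to89
open Literature.MathematicalPhysics.QuantumFieldTheory.Balaban1983to89.Beta
open B5Prop11Plancherel (fine)
open B6Lemma24Torus (pbox mem_pbox wrap)
open B4TorusKernel.MultiPeriod (translate translate_apply)
open AffineAveraging (Site Form1 box toSite)
open AveragingContoursRooted (ctr ctrOff)
open AveragingHessianKernels (Bond)
open Summit.QuantumFields.BalabanUV.Beta.BorderedHessian (stepScale)
open Summit.QuantumFields.BalabanUV.Beta.SymAveragingHessianCounts (symVhKerAt symLinKerAt)
open Summit.QuantumFields.BalabanUV.Beta.SymAveragingMixedJetTables (symVh2KerAt)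
open Summit.QuantumFields.BalabanUV.Beta.FP.TorusGaugeCovariancePairing (wrapPt wrapPt_coe wrapPt_of_mem)
open Summit.QuantumFields.BalabanUV.Beta.FP.TorusCompositeObjects (towerTorus)
open Summit.QuantumFields.BalabanUV.Beta.FP.TorusCompositeObjectsG (QstepSym compRowsSym)
open Summit.QuantumFields.BalabanUV.Beta.FP.TorusCompositeRowsSymPeriodic (sum_QstepSym_mul_periodic sum_compRowsSym_mul_periodic_of_clauses)
open Summit.QuantumFields.BalabanUV.Beta.FP.TorusStepInsertionSym (stepIns₁Sym sum_stepIns₁Sym_mul_periodic)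
open Summit.QuantumFields.BalabanUV.Beta.FP.TorusStepInsertionSymTwo (stepIns₂₂Sym)
open Summit.QuantumFields.BalabanUV.Beta.FP.TorusStepInsertionSymTwoStep (sum_stepIns₂₂Sym_mul_periodic)
open Summit.QuantumFields.BalabanUV.Beta.FP.TorusCompositeCovarianceOneSym (compIns₁Sym)
open Summit.QuantumFields.BalabanUV.Beta.FP.TorusCompositeCovarianceTwoPolarSym (compIns₂₂Sym compIns₂₂Sym_zero compIns₂₂Sym_succ)
open Summit.QuantumFields.BalabanUV.Beta.FP.TorusCompositeInsertionPeriodic (lift_periodic periodic_apply_wrap)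
open Summit.QuantumFields.BalabanUV.Beta.FP.TorusCompositeInsertionPeriodicSym (compRowsSym_mulVec_eq_of_clauses
  sum_compIns₁Sym_mul_periodic symVhKerAt_form_translate symLinKerAt_form_translate rows_periodic_of_clauses periodic_of_clauses)

variable {d : ℕ} (Lc : ℕ) [NeZero Lc]

/-! ## §1 The sym composite second-order insertion bi-jet acts on periodic forms as any bi-functional obeying our sym second chain rule -/

/-- [folklore] **`sum_compIns₂₂Sym_mul_periodic` — THE SYM COMPOSITE SECOND-ORDER INSERTION BI-JET ACTS ON PERIODIC 1-FORMS AS ANY LATTICE BI-FUNCTIONAL OBEYING OUR SYM SECOND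
CHAIN RULE.**  `𝓡` carries the sym rows clauses `hR0 hRsucc hRper`; `𝓘₁` carries the order-1 letters `h0₁ hsucc₁ hper₁`; `𝓘₂ lev n H H′ B : Form1` carries `h0₂` (depth 0 is 0),
`hsucc₂` — OUR successor clause VERBATIM from `compIns₂₂Sym_succ`: `θ₂ ·` an1's symmetrised `½(symVh2KerAt f g g′ + symVh2KerAt f g′ g)` at the centre `ctr (d+1) Lc` against
(the lower rows functional `𝓡′ B`, the two lifted transported directions `𝓡′ H′`, `𝓡′ H`) `+ θ₁ ·` (an1's `symVhKerAt` at the centre against (the lower ORDER-1 functional of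
`(H′, B)`, `𝓡′ H`) + the same with `H ↔ H′`) `+ stepScale d Lc (lev 1) · Lc^{d+1} · Σ symLinKerAt (ctr)` of the lower bi-functional —, and `hper₂` (finest-periodic triples ↦
top-periodic forms).  Conclusion (at the centred tower `hc`, every root list `rs`):
`Σ_q compIns₂₂Sym Lc M lev rs n h h′ (x,κ₀) q · B q.2 q.1 = 𝓘₂ lev n (lift h) (lift h′) B κ₀ x`. -/
theorem sum_compIns₂₂Sym_mul_periodic (hc : ctrOff (d + 1) Lc ∈ box (d + 1) Lc)
    (𝓡 : (ℕ → ℕ) → ℕ → Form1 (d + 1) ℝ → Form1 (d + 1) ℝ)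
    (hR0 : ∀ (lev : ℕ → ℕ) (B : Form1 (d + 1) ℝ), 𝓡 lev 0 B = B)
    (hRsucc : ∀ (lev : ℕ → ℕ) (n : ℕ) (B : Form1 (d + 1) ℝ) (κ : Fin (d + 1)) (x : Site (d + 1)),
      𝓡 lev (n + 1) B κ x = stepScale d Lc (lev 1) * ((Lc : ℝ) ^ (d + 1)
        * ∑' z : Site (d + 1), ∑ l : Fin (d + 1), symLinKerAt (ctr (d + 1) Lc) Lc κ x (l, z) * 𝓡 (fun k => lev (k + 1)) n B l z))
    (hRper : ∀ (lev : ℕ → ℕ) (n : ℕ) (T : Fin (d + 1) → ℕ) (B : Form1 (d + 1) ℝ),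
      (∀ (l : Fin (d + 1)) (y m : Site (d + 1)), B l (translate (towerTorus Lc T n) y m) = B l y) →
        ∀ (l : Fin (d + 1)) (y m : Site (d + 1)), 𝓡 lev n B l (translate T y m) = 𝓡 lev n B l y)
    (𝓘₁ : (ℕ → ℕ) → ℕ → Form1 (d + 1) ℝ → Form1 (d + 1) ℝ → Form1 (d + 1) ℝ)
    (h0₁ : ∀ (lev : ℕ → ℕ) (H B : Form1 (d + 1) ℝ), 𝓘₁ lev 0 H B = 0)
    (hsucc₁ : ∀ (lev : ℕ → ℕ) (n : ℕ) (H B : Form1 (d + 1) ℝ) (κ : Fin (d + 1)) (x : Site (d + 1)),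
      𝓘₁ lev (n + 1) H B κ x
        = (((Lc : ℝ) ^ (d + 1) * stepScale d Lc (lev 1)) * (∏ i ∈ Finset.range n, (stepScale d Lc (lev (i + 1 + 1)) * ((box (d + 1) Lc).card : ℝ)))⁻¹) *
            (∑' u : Site (d + 1), ∑ κ' : Fin (d + 1),
              (∑' z : Site (d + 1), ∑ l : Fin (d + 1), symVhKerAt (ctr (d + 1) Lc) Lc κ x (l, z) (κ', u) * 𝓡 (fun k => lev (k + 1)) n B l z) *
                𝓡 (fun k => lev (k + 1)) n H κ' u)
          + stepScale d Lc (lev 1) * ((Lc : ℝ) ^ (d + 1) *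
              ∑' z : Site (d + 1), ∑ l : Fin (d + 1), symLinKerAt (ctr (d + 1) Lc) Lc κ x (l, z) * 𝓘₁ (fun k => lev (k + 1)) n H B l z))
    (hper₁ : ∀ (lev : ℕ → ℕ) (n : ℕ) (M : Fin (d + 1) → ℕ) (H B : Form1 (d + 1) ℝ),
      (∀ (l : Fin (d + 1)) (w t : Site (d + 1)), H l (translate (towerTorus Lc M n) w t) = H l w) →
      (∀ (l : Fin (d + 1)) (w t : Site (d + 1)), B l (translate (towerTorus Lc M n) w t) = B l w) →
      ∀ (l : Fin (d + 1)) (y t : Site (d + 1)), 𝓘₁ lev n H B l (translate M y t) = 𝓘₁ lev n H B l y)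
    (𝓘₂ : (ℕ → ℕ) → ℕ → Form1 (d + 1) ℝ → Form1 (d + 1) ℝ → Form1 (d + 1) ℝ → Form1 (d + 1) ℝ)
    (h0₂ : ∀ (lev : ℕ → ℕ) (H H' B : Form1 (d + 1) ℝ), 𝓘₂ lev 0 H H' B = 0)
    (hsucc₂ : ∀ (lev : ℕ → ℕ) (n : ℕ) (H H' B : Form1 (d + 1) ℝ) (κ₀ : Fin (d + 1)) (x : Site (d + 1)),
      𝓘₂ lev (n + 1) H H' B κ₀ x
        = ((((Lc : ℝ) ^ (d + 1) * stepScale d Lc (lev 1)) * (∏ i ∈ Finset.range n, (stepScale d Lc (lev (i + 1 + 1)) * ((box (d + 1) Lc).card : ℝ)))⁻¹)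
            * (∏ i ∈ Finset.range n, (stepScale d Lc (lev (i + 1 + 1)) * ((box (d + 1) Lc).card : ℝ)))⁻¹) *
            (∑' u : Site (d + 1), ∑ κ : Fin (d + 1), (∑' u' : Site (d + 1), ∑ κ' : Fin (d + 1),
              (∑' z : Site (d + 1), ∑ l : Fin (d + 1),
                (1 / 2 : ℝ) * (symVh2KerAt (ctr (d + 1) Lc) Lc κ₀ x (l, z) (κ, u) (κ', u') + symVh2KerAt (ctr (d + 1) Lc) Lc κ₀ x (l, z) (κ', u') (κ, u)) *
                  𝓡 (fun k => lev (k + 1)) n B l z) *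
              𝓡 (fun k => lev (k + 1)) n H' κ' u') * 𝓡 (fun k => lev (k + 1)) n H κ u)
          + (((Lc : ℝ) ^ (d + 1) * stepScale d Lc (lev 1)) * (∏ i ∈ Finset.range n, (stepScale d Lc (lev (i + 1 + 1)) * ((box (d + 1) Lc).card : ℝ)))⁻¹) *
            ((∑' u : Site (d + 1), ∑ κ' : Fin (d + 1),
              (∑' z : Site (d + 1), ∑ l : Fin (d + 1), symVhKerAt (ctr (d + 1) Lc) Lc κ₀ x (l, z) (κ', u) * 𝓘₁ (fun k => lev (k + 1)) n H' B l z) *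
                𝓡 (fun k => lev (k + 1)) n H κ' u)
            + (∑' u : Site (d + 1), ∑ κ' : Fin (d + 1),
              (∑' z : Site (d + 1), ∑ l : Fin (d + 1), symVhKerAt (ctr (d + 1) Lc) Lc κ₀ x (l, z) (κ', u) * 𝓘₁ (fun k => lev (k + 1)) n H B l z) *
                𝓡 (fun k => lev (k + 1)) n H' κ' u))
          + stepScale d Lc (lev 1) * ((Lc : ℝ) ^ (d + 1) *
              ∑' z : Site (d + 1), ∑ l : Fin (d + 1), symLinKerAt (ctr (d + 1) Lc) Lc κ₀ x (l, z) * 𝓘₂ (fun k => lev (k + 1)) n H H' B l z))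
    (hper₂ : ∀ (lev : ℕ → ℕ) (n : ℕ) (M : Fin (d + 1) → ℕ) (H H' B : Form1 (d + 1) ℝ),
      (∀ (l : Fin (d + 1)) (w t : Site (d + 1)), H l (translate (towerTorus Lc M n) w t) = H l w) →
      (∀ (l : Fin (d + 1)) (w t : Site (d + 1)), H' l (translate (towerTorus Lc M n) w t) = H' l w) →
      (∀ (l : Fin (d + 1)) (w t : Site (d + 1)), B l (translate (towerTorus Lc M n) w t) = B l w) →
      ∀ (l : Fin (d + 1)) (y t : Site (d + 1)), 𝓘₂ lev n H H' B l (translate M y t) = 𝓘₂ lev n H H' B l y) :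
    ∀ (n : ℕ) (M : Fin (d + 1) → ℕ) [∀ μ, NeZero (M μ)] (lev : ℕ → ℕ) (rs : ℕ → (Fin (d + 1) → ℕ))
      (h h' : ↥(pbox (towerTorus Lc M n)) × Fin (d + 1) → ℝ) (B : Form1 (d + 1) ℝ)
      (_ : ∀ (l : Fin (d + 1)) (w t : Site (d + 1)), B l (translate (towerTorus Lc M n) w t) = B l w) (x : ↥(pbox M)) (κ₀ : Fin (d + 1)),
      ∑ q : ↥(pbox (towerTorus Lc M n)) × Fin (d + 1), compIns₂₂Sym Lc M lev rs n h h' (x, κ₀) q * B q.2 (q.1 : Site (d + 1))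
        = 𝓘₂ lev n (fun l w => h (wrapPt (towerTorus Lc M n) w, l)) (fun l w => h' (wrapPt (towerTorus Lc M n) w, l)) B κ₀ (x : Site (d + 1))
  | 0, M, _, lev, rs, h, h', B, hB, x, κ₀ => by
      rw [h0₂, compIns₂₂Sym_zero]
      simp only [Matrix.zero_apply, zero_mul, Finset.sum_const_zero]
      rfl
  | n + 1, M, _, lev, rs, h, h', B, hB, x, κ₀ => by
      -- spell every finest-torus object over the lower tower `(fine Lc M, n)` (definitionally the same torus, `towerTorus_succ`)
      change ↥(pbox (towerTorus Lc (fine Lc M) n)) × Fin (d + 1) → ℝ at h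
      change ↥(pbox (towerTorus Lc (fine Lc M) n)) × Fin (d + 1) → ℝ at h'
      change ∀ (l : Fin (d + 1)) (w t : Site (d + 1)), B l (translate (towerTorus Lc (fine Lc M) n) w t) = B l w at hB
      show ∑ q : ↥(pbox (towerTorus Lc (fine Lc M) n)) × Fin (d + 1), compIns₂₂Sym Lc M lev rs (n + 1) h h' (x, κ₀) q * B q.2 (q.1 : Site (d + 1))
        = 𝓘₂ lev (n + 1) (fun l w => h (wrapPt (towerTorus Lc (fine Lc M) n) w, l)) (fun l w => h' (wrapPt (towerTorus Lc (fine Lc M) n) w, l)) B κ₀ (x : Site (d + 1))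
      -- the lifted directions are finest-periodic
      have hHper : ∀ (l : Fin (d + 1)) (w t : Site (d + 1)), (fun l w => h (wrapPt (towerTorus Lc (fine Lc M) n) w, l)) l (translate (towerTorus Lc (fine Lc M) n) w t)
          = (fun l w => h (wrapPt (towerTorus Lc (fine Lc M) n) w, l)) l w :=
        fun l w t => lift_periodic (towerTorus Lc (fine Lc M) n) h l w t
      have hH'per : ∀ (l : Fin (d + 1)) (w t : Site (d + 1)), (fun l w => h' (wrapPt (towerTorus Lc (fine Lc M) n) w, l)) l (translate (towerTorus Lc (fine Lc M) n) w t)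
          = (fun l w => h' (wrapPt (towerTorus Lc (fine Lc M) n) w, l)) l w :=
        fun l w t => lift_periodic (towerTorus Lc (fine Lc M) n) h' l w t
      -- induction hypothesis on the lower tower; the ORDER-1 sym junction on the lower tower for each direction
      have IH := sum_compIns₂₂Sym_mul_periodic hc 𝓡 hR0 hRsucc hRper 𝓘₁ h0₁ hsucc₁ hper₁ 𝓘₂ h0₂ hsucc₂ hper₂ n (fine Lc M) (fun k => lev (k + 1)) (fun k => rs (k + 1)) h h' B hB
      have I1 := sum_compIns₁Sym_mul_periodic Lc hc 𝓡 hR0 hRsucc hRper 𝓘₁ h0₁ hsucc₁ hper₁ n (fine Lc M) (fun k => lev (k + 1)) (fun k => rs (k + 1)) h B hB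
      have I1' := sum_compIns₁Sym_mul_periodic Lc hc 𝓡 hR0 hRsucc hRper 𝓘₁ h0₁ hsucc₁ hper₁ n (fine Lc M) (fun k => lev (k + 1)) (fun k => rs (k + 1)) h' B hB
      -- periodicity under the top box `fine Lc M` of the lower functionals
      have hI2per := hper₂ (fun k => lev (k + 1)) n (fine Lc M) (fun l w => h (wrapPt (towerTorus Lc (fine Lc M) n) w, l))
        (fun l w => h' (wrapPt (towerTorus Lc (fine Lc M) n) w, l)) B hHper hH'per hB
      have hI1per := hper₁ (fun k => lev (k + 1)) n (fine Lc M) (fun l w => h (wrapPt (towerTorus Lc (fine Lc M) n) w, l)) B hHper hB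
      have hI1'per := hper₁ (fun k => lev (k + 1)) n (fine Lc M) (fun l w => h' (wrapPt (towerTorus Lc (fine Lc M) n) w, l)) B hH'per hB
      have hBlow : ∀ (l : Fin (d + 1)) (y t : Site (d + 1)), 𝓡 (fun k => lev (k + 1)) n B l (translate (fine Lc M) y t) = 𝓡 (fun k => lev (k + 1)) n B l y :=
        hRper (fun k => lev (k + 1)) n (fine Lc M) B hB
      -- the transported directions read at box points
      have hv : ∀ (u : Site (d + 1)) (κ' : Fin (d + 1)), ((compRowsSym Lc (fine Lc M) (fun k => lev (k + 1)) (fun k => rs (k + 1)) n) *ᵥ h) (wrapPt (fine Lc M) u, κ')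
          = 𝓡 (fun k => lev (k + 1)) n (fun l w => h (wrapPt (towerTorus Lc (fine Lc M) n) w, l)) κ' u := fun u κ' => by
        rw [compRowsSym_mulVec_eq_of_clauses Lc 𝓡 hR0 hRsucc hRper n (fine Lc M) (fun k => lev (k + 1)) (fun k => rs (k + 1)) h (wrapPt (fine Lc M) u) κ']
        exact periodic_apply_wrap (fine Lc M) _ (hRper _ n (fine Lc M) _ hHper) κ' u
      have hv' : ∀ (u : Site (d + 1)) (κ' : Fin (d + 1)), ((compRowsSym Lc (fine Lc M) (fun k => lev (k + 1)) (fun k => rs (k + 1)) n) *ᵥ h') (wrapPt (fine Lc M) u, κ')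
          = 𝓡 (fun k => lev (k + 1)) n (fun l w => h' (wrapPt (towerTorus Lc (fine Lc M) n) w, l)) κ' u := fun u κ' => by
        rw [compRowsSym_mulVec_eq_of_clauses Lc 𝓡 hR0 hRsucc hRper n (fine Lc M) (fun k => lev (k + 1)) (fun k => rs (k + 1)) h' (wrapPt (fine Lc M) u) κ']
        exact periodic_apply_wrap (fine Lc M) _ (hRper _ n (fine Lc M) _ hH'per) κ' u
      -- the three lower actions on the slots of `fine Lc M`: sym rows (`𝓡`), order-1 sym jets (`𝓘₁`), the lower bi-jet (induction hypothesis)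
      have hrows : ∀ p : ↥(pbox (fine Lc M)) × Fin (d + 1), ∑ q : ↥(pbox (towerTorus Lc (fine Lc M) n)) × Fin (d + 1),
          compRowsSym Lc (fine Lc M) (fun k => lev (k + 1)) (fun k => rs (k + 1)) n p q * B q.2 (q.1 : Site (d + 1)) = 𝓡 (fun k => lev (k + 1)) n B p.2 (p.1 : Site (d + 1)) :=
        fun p => by
          obtain ⟨y, l⟩ := p
          exact sum_compRowsSym_mul_periodic_of_clauses Lc 𝓡 hR0 hRsucc hRper n (fine Lc M) (fun k => lev (k + 1)) (fun k => rs (k + 1)) B hB y l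
      have hlow1 : ∀ p : ↥(pbox (fine Lc M)) × Fin (d + 1), ∑ q : ↥(pbox (towerTorus Lc (fine Lc M) n)) × Fin (d + 1),
          compIns₁Sym Lc (fine Lc M) (fun k => lev (k + 1)) (fun k => rs (k + 1)) n h p q * B q.2 (q.1 : Site (d + 1))
            = 𝓘₁ (fun k => lev (k + 1)) n (fun l w => h (wrapPt (towerTorus Lc (fine Lc M) n) w, l)) B p.2 (p.1 : Site (d + 1)) :=
        fun p => by obtain ⟨y, l⟩ := p; exact I1 y l
      have hlow1' : ∀ p : ↥(pbox (fine Lc M)) × Fin (d + 1), ∑ q : ↥(pbox (towerTorus Lc (fine Lc M) n)) × Fin (d + 1),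
          compIns₁Sym Lc (fine Lc M) (fun k => lev (k + 1)) (fun k => rs (k + 1)) n h' p q * B q.2 (q.1 : Site (d + 1))
            = 𝓘₁ (fun k => lev (k + 1)) n (fun l w => h' (wrapPt (towerTorus Lc (fine Lc M) n) w, l)) B p.2 (p.1 : Site (d + 1)) :=
        fun p => by obtain ⟨y, l⟩ := p; exact I1' y l
      have hlow2 : ∀ p : ↥(pbox (fine Lc M)) × Fin (d + 1), ∑ q : ↥(pbox (towerTorus Lc (fine Lc M) n)) × Fin (d + 1),
          compIns₂₂Sym Lc (fine Lc M) (fun k => lev (k + 1)) (fun k => rs (k + 1)) n h h' p q * B q.2 (q.1 : Site (d + 1))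
            = 𝓘₂ (fun k => lev (k + 1)) n (fun l w => h (wrapPt (towerTorus Lc (fine Lc M) n) w, l)) (fun l w => h' (wrapPt (towerTorus Lc (fine Lc M) n) w, l)) B p.2
                (p.1 : Site (d + 1)) :=
        fun p => by obtain ⟨y, l⟩ := p; exact IH y l
      -- a product of matrices acting on the form's values, entrywise
      have hprod : ∀ (X : Matrix (↥(pbox M) × Fin (d + 1)) (↥(pbox (fine Lc M)) × Fin (d + 1)) ℝ)
          (Y : Matrix (↥(pbox (fine Lc M)) × Fin (d + 1)) (↥(pbox (towerTorus Lc (fine Lc M) n)) × Fin (d + 1)) ℝ),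
          ∑ q : ↥(pbox (towerTorus Lc (fine Lc M) n)) × Fin (d + 1), (X * Y) (x, κ₀) q * B q.2 (q.1 : Site (d + 1))
            = ∑ p : ↥(pbox (fine Lc M)) × Fin (d + 1), X (x, κ₀) p * ∑ q : ↥(pbox (towerTorus Lc (fine Lc M) n)) × Fin (d + 1), Y p q * B q.2 (q.1 : Site (d + 1)) :=
        fun X Y => by
          simp only [Matrix.mul_apply, Finset.sum_mul, Finset.mul_sum, mul_assoc]
          exact Finset.sum_comm
      have hsmul : ∀ (t : ℝ) (X : Matrix (↥(pbox M) × Fin (d + 1)) (↥(pbox (towerTorus Lc (fine Lc M) n)) × Fin (d + 1)) ℝ),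
          ∑ q : ↥(pbox (towerTorus Lc (fine Lc M) n)) × Fin (d + 1), (t • X) (x, κ₀) q * B q.2 (q.1 : Site (d + 1))
            = t * ∑ q : ↥(pbox (towerTorus Lc (fine Lc M) n)) × Fin (d + 1), X (x, κ₀) q * B q.2 (q.1 : Site (d + 1)) := fun t X => by
        rw [Finset.mul_sum]
        exact Finset.sum_congr rfl fun q _ => by rw [Matrix.smul_apply, smul_eq_mul, mul_assoc]
      -- the chain rule, entrywise: three summands
      rw [hsucc₂, compIns₂₂Sym_succ]
      simp only [Matrix.add_apply, add_mul, Finset.sum_add_distrib]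
      congr 1
      · congr 1
        · -- TOP TERM: unit × (the lower sym rows through the sym bi-jet) = `sum_stepIns₂₂Sym_mul_periodic` at (`𝓡′ B`, the two lifts)
          rw [hsmul]
          congr 1
          rw [hprod, Finset.sum_congr rfl fun p _ => by rw [hrows p]]
          refine (sum_stepIns₂₂Sym_mul_periodic M Lc hc ((compRowsSym Lc (fine Lc M) (fun k => lev (k + 1)) (fun k => rs (k + 1)) n) *ᵥ h)
            ((compRowsSym Lc (fine Lc M) (fun k => lev (k + 1)) (fun k => rs (k + 1)) n) *ᵥ h') (𝓡 (fun k => lev (k + 1)) n B) hBlow x κ₀).trans ?_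
          refine tsum_congr fun u => Finset.sum_congr rfl fun κ _ => ?_
          rw [hv u κ]
          congr 1
          exact tsum_congr fun u' => Finset.sum_congr rfl fun κ' _ => by rw [hv' u' κ']
        · -- MIXED TERMS: unit × (`stepIns₁Sym` along one transported direction on the lower order-1 functional of the other), both orders
          rw [hsmul]
          congr 1
          simp only [Matrix.add_apply, add_mul, Finset.sum_add_distrib]
          congr 1
          · rw [hprod, Finset.sum_congr rfl fun p _ => by rw [hlow1' p]]
            exact (sum_stepIns₁Sym_mul_periodic M Lc hc ((compRowsSym Lc (fine Lc M) (fun k => lev (k + 1)) (fun k => rs (k + 1)) n) *ᵥ h)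
                (𝓘₁ (fun k => lev (k + 1)) n (fun l w => h' (wrapPt (towerTorus Lc (fine Lc M) n) w, l)) B) hI1'per x κ₀).trans
              (tsum_congr fun u => Finset.sum_congr rfl fun κ' _ => by rw [hv u κ'])
          · rw [hprod, Finset.sum_congr rfl fun p _ => by rw [hlow1 p]]
            exact (sum_stepIns₁Sym_mul_periodic M Lc hc ((compRowsSym Lc (fine Lc M) (fun k => lev (k + 1)) (fun k => rs (k + 1)) n) *ᵥ h')
                (𝓘₁ (fun k => lev (k + 1)) n (fun l w => h (wrapPt (towerTorus Lc (fine Lc M) n) w, l)) B) hI1per x κ₀).trans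
              (tsum_congr fun u => Finset.sum_congr rfl fun κ' _ => by rw [hv' u κ'])
      · -- LOWER TERM: the top sym rows act as `stepScale · Lc^{d+1} · Σ symLinKerAt (ctr)` on the (periodic) lower bi-functional
        rw [hprod, Finset.sum_congr rfl fun p _ => by rw [hlow2 p]]
        exact sum_QstepSym_mul_periodic Lc M (lev 1) (𝓘₂ (fun k => lev (k + 1)) n (fun l w => h (wrapPt (towerTorus Lc (fine Lc M) n) w, l))
          (fun l w => h' (wrapPt (towerTorus Lc (fine Lc M) n) w, l)) B) hI2per x κ₀

/-! ## §2 The periodicity letter `hper₂` FOLLOWS from the clauses (order 2) -/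

omit [NeZero Lc] in
/-- [folklore] the top summand of the order-2 successor clause is periodic under the top box: for forms `W, W′, B′` periodic under `fine Lc M`, the symmetrised
`symVh2KerAt` triple form `x ↦ Σ'_u Σ_κ (Σ'_{u′} Σ_{κ′} (Σ'_z Σ_l ½(symVh2KerAt ρ Lc κ₀ x (l,z) (κ,u) (κ′,u′) + (κ,u) ↔ (κ′,u′)) · B′ l z) · W′ κ′ u′) · W κ u` is `M`-periodic
(an1's `symVh2KerAt_add`; three bond sums re-indexed by `Equiv.addRight`). -/
theorem symVh2KerAt_form_translate (M : Fin (d + 1) → ℕ) (ρ : Site (d + 1)) (W W' B' : Form1 (d + 1) ℝ)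
    (hW : ∀ (l : Fin (d + 1)) (y m : Site (d + 1)), W l (translate (fine Lc M) y m) = W l y)
    (hW' : ∀ (l : Fin (d + 1)) (y m : Site (d + 1)), W' l (translate (fine Lc M) y m) = W' l y)
    (hB' : ∀ (l : Fin (d + 1)) (y m : Site (d + 1)), B' l (translate (fine Lc M) y m) = B' l y) (κ₀ : Fin (d + 1)) (y t : Site (d + 1)) :
    (∑' u : Site (d + 1), ∑ κ : Fin (d + 1), (∑' u' : Site (d + 1), ∑ κ' : Fin (d + 1), (∑' z : Site (d + 1), ∑ l : Fin (d + 1),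
        (1 / 2 : ℝ) * (symVh2KerAt ρ Lc κ₀ (translate M y t) (l, z) (κ, u) (κ', u') + symVh2KerAt ρ Lc κ₀ (translate M y t) (l, z) (κ', u') (κ, u)) * B' l z)
          * W' κ' u') * W κ u)
      = ∑' u : Site (d + 1), ∑ κ : Fin (d + 1), (∑' u' : Site (d + 1), ∑ κ' : Fin (d + 1), (∑' z : Site (d + 1), ∑ l : Fin (d + 1),
        (1 / 2 : ℝ) * (symVh2KerAt ρ Lc κ₀ y (l, z) (κ, u) (κ', u') + symVh2KerAt ρ Lc κ₀ y (l, z) (κ', u') (κ, u)) * B' l z) * W' κ' u') * W κ u := by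
  have eadd : ∀ w : Site (d + 1), (w + (fun i => (fine Lc M i : ℤ) * t i)) = translate (fine Lc M) w t := fun w => by
    funext i; simp [B4TorusKernel.MultiPeriod.translate_apply]
  have hy : translate M y t = y + fun i => (M i : ℤ) * t i := by funext i; simp [B4TorusKernel.MultiPeriod.translate_apply]
  have hsh : ∀ (α : Fin (d + 1)) (w : Site (d + 1)),
      ((α, translate (fine Lc M) w t) : Bond (d + 1)) = AveragingHessianKernels.Bond.sh (α, w) ((Lc : ℤ) • fun i => (M i : ℤ) * t i) := fun α w =>
    Prod.ext rfl (funext fun i => by simp [B4TorusKernel.MultiPeriod.translate_apply, fine, Nat.cast_mul, mul_assoc])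
  have hK : ∀ (l : Fin (d + 1)) (z : Site (d + 1)) (κ : Fin (d + 1)) (u : Site (d + 1)) (κ' : Fin (d + 1)) (u' : Site (d + 1)),
      symVh2KerAt ρ Lc κ₀ (translate M y t) (l, translate (fine Lc M) z t) (κ, translate (fine Lc M) u t) (κ', translate (fine Lc M) u' t)
        = symVh2KerAt ρ Lc κ₀ y (l, z) (κ, u) (κ', u') := fun l z κ u κ' u' => by
    rw [hy, hsh, hsh, hsh]
    exact SymAveragingMixedJetTables.symVh2KerAt_add ρ Lc κ₀ y (fun i => (M i : ℤ) * t i) (l, z) (κ, u) (κ', u')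
  rw [← (Equiv.addRight (fun i => (fine Lc M i : ℤ) * t i)).tsum_eq (fun u => ∑ κ : Fin (d + 1), (∑' u' : Site (d + 1), ∑ κ' : Fin (d + 1), (∑' z : Site (d + 1), ∑ l : Fin (d + 1),
        (1 / 2 : ℝ) * (symVh2KerAt ρ Lc κ₀ (translate M y t) (l, z) (κ, u) (κ', u') + symVh2KerAt ρ Lc κ₀ (translate M y t) (l, z) (κ', u') (κ, u)) * B' l z)
          * W' κ' u') * W κ u)]
  refine tsum_congr fun u => Finset.sum_congr rfl fun κ _ => ?_
  simp only [Equiv.coe_addRight]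
  rw [eadd u, hW]
  refine congrArg (fun s : ℝ => s * W κ u) ?_
  rw [← (Equiv.addRight (fun i => (fine Lc M i : ℤ) * t i)).tsum_eq (fun u' => ∑ κ' : Fin (d + 1), (∑' z : Site (d + 1), ∑ l : Fin (d + 1),
        (1 / 2 : ℝ) * (symVh2KerAt ρ Lc κ₀ (translate M y t) (l, z) (κ, translate (fine Lc M) u t) (κ', u')
          + symVh2KerAt ρ Lc κ₀ (translate M y t) (l, z) (κ', u') (κ, translate (fine Lc M) u t)) * B' l z) * W' κ' u')]
  refine tsum_congr fun u' => Finset.sum_congr rfl fun κ' _ => ?_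
  simp only [Equiv.coe_addRight]
  rw [eadd u', hW']
  refine congrArg (fun s : ℝ => s * W' κ' u') ?_
  rw [← (Equiv.addRight (fun i => (fine Lc M i : ℤ) * t i)).tsum_eq (fun z => ∑ l : Fin (d + 1),
        (1 / 2 : ℝ) * (symVh2KerAt ρ Lc κ₀ (translate M y t) (l, z) (κ, translate (fine Lc M) u t) (κ', translate (fine Lc M) u' t)
          + symVh2KerAt ρ Lc κ₀ (translate M y t) (l, z) (κ', translate (fine Lc M) u' t) (κ, translate (fine Lc M) u t)) * B' l z)]
  refine tsum_congr fun z => Finset.sum_congr rfl fun l _ => ?_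
  simp only [Equiv.coe_addRight]
  rw [eadd z, hB', hK, hK]

omit [NeZero Lc] in
/-- [folklore] **`periodic_of_clauses₂` — THE LETTER `hper₂` OF `sum_compIns₂₂Sym_mul_periodic` FOLLOWS FROM THE CLAUSES** (`hR0 hRsucc` for the rows functionals through
`rows_periodic_of_clauses`; `h0₁ hsucc₁` of order 1 for the mixed summands through `periodic_of_clauses`; `h0₂ hsucc₂`): finest-periodic `(H, H′, B)` ↦ `M`-periodic
`𝓘₂ lev n H H′ B`. -/
theorem periodic_of_clauses₂ (𝓡 : (ℕ → ℕ) → ℕ → Form1 (d + 1) ℝ → Form1 (d + 1) ℝ)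
    (hR0 : ∀ (lev : ℕ → ℕ) (B : Form1 (d + 1) ℝ), 𝓡 lev 0 B = B)
    (hRsucc : ∀ (lev : ℕ → ℕ) (n : ℕ) (B : Form1 (d + 1) ℝ) (κ : Fin (d + 1)) (x : Site (d + 1)),
      𝓡 lev (n + 1) B κ x = stepScale d Lc (lev 1) * ((Lc : ℝ) ^ (d + 1)
        * ∑' z : Site (d + 1), ∑ l : Fin (d + 1), symLinKerAt (ctr (d + 1) Lc) Lc κ x (l, z) * 𝓡 (fun k => lev (k + 1)) n B l z))
    (𝓘₁ : (ℕ → ℕ) → ℕ → Form1 (d + 1) ℝ → Form1 (d + 1) ℝ → Form1 (d + 1) ℝ)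
    (h0₁ : ∀ (lev : ℕ → ℕ) (H B : Form1 (d + 1) ℝ), 𝓘₁ lev 0 H B = 0)
    (hsucc₁ : ∀ (lev : ℕ → ℕ) (n : ℕ) (H B : Form1 (d + 1) ℝ) (κ : Fin (d + 1)) (x : Site (d + 1)),
      𝓘₁ lev (n + 1) H B κ x
        = (((Lc : ℝ) ^ (d + 1) * stepScale d Lc (lev 1)) * (∏ i ∈ Finset.range n, (stepScale d Lc (lev (i + 1 + 1)) * ((box (d + 1) Lc).card : ℝ)))⁻¹) *
            (∑' u : Site (d + 1), ∑ κ' : Fin (d + 1),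
              (∑' z : Site (d + 1), ∑ l : Fin (d + 1), symVhKerAt (ctr (d + 1) Lc) Lc κ x (l, z) (κ', u) * 𝓡 (fun k => lev (k + 1)) n B l z) *
                𝓡 (fun k => lev (k + 1)) n H κ' u)
          + stepScale d Lc (lev 1) * ((Lc : ℝ) ^ (d + 1) *
              ∑' z : Site (d + 1), ∑ l : Fin (d + 1), symLinKerAt (ctr (d + 1) Lc) Lc κ x (l, z) * 𝓘₁ (fun k => lev (k + 1)) n H B l z))
    (𝓘₂ : (ℕ → ℕ) → ℕ → Form1 (d + 1) ℝ → Form1 (d + 1) ℝ → Form1 (d + 1) ℝ → Form1 (d + 1) ℝ)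
    (h0₂ : ∀ (lev : ℕ → ℕ) (H H' B : Form1 (d + 1) ℝ), 𝓘₂ lev 0 H H' B = 0)
    (hsucc₂ : ∀ (lev : ℕ → ℕ) (n : ℕ) (H H' B : Form1 (d + 1) ℝ) (κ₀ : Fin (d + 1)) (x : Site (d + 1)),
      𝓘₂ lev (n + 1) H H' B κ₀ x
        = ((((Lc : ℝ) ^ (d + 1) * stepScale d Lc (lev 1)) * (∏ i ∈ Finset.range n, (stepScale d Lc (lev (i + 1 + 1)) * ((box (d + 1) Lc).card : ℝ)))⁻¹)
            * (∏ i ∈ Finset.range n, (stepScale d Lc (lev (i + 1 + 1)) * ((box (d + 1) Lc).card : ℝ)))⁻¹) *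
            (∑' u : Site (d + 1), ∑ κ : Fin (d + 1), (∑' u' : Site (d + 1), ∑ κ' : Fin (d + 1),
              (∑' z : Site (d + 1), ∑ l : Fin (d + 1),
                (1 / 2 : ℝ) * (symVh2KerAt (ctr (d + 1) Lc) Lc κ₀ x (l, z) (κ, u) (κ', u') + symVh2KerAt (ctr (d + 1) Lc) Lc κ₀ x (l, z) (κ', u') (κ, u)) *
                  𝓡 (fun k => lev (k + 1)) n B l z) *
              𝓡 (fun k => lev (k + 1)) n H' κ' u') * 𝓡 (fun k => lev (k + 1)) n H κ u)
          + (((Lc : ℝ) ^ (d + 1) * stepScale d Lc (lev 1)) * (∏ i ∈ Finset.range n, (stepScale d Lc (lev (i + 1 + 1)) * ((box (d + 1) Lc).card : ℝ)))⁻¹) *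
            ((∑' u : Site (d + 1), ∑ κ' : Fin (d + 1),
              (∑' z : Site (d + 1), ∑ l : Fin (d + 1), symVhKerAt (ctr (d + 1) Lc) Lc κ₀ x (l, z) (κ', u) * 𝓘₁ (fun k => lev (k + 1)) n H' B l z) *
                𝓡 (fun k => lev (k + 1)) n H κ' u)
            + (∑' u : Site (d + 1), ∑ κ' : Fin (d + 1),
              (∑' z : Site (d + 1), ∑ l : Fin (d + 1), symVhKerAt (ctr (d + 1) Lc) Lc κ₀ x (l, z) (κ', u) * 𝓘₁ (fun k => lev (k + 1)) n H B l z) *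
                𝓡 (fun k => lev (k + 1)) n H' κ' u))
          + stepScale d Lc (lev 1) * ((Lc : ℝ) ^ (d + 1) *
              ∑' z : Site (d + 1), ∑ l : Fin (d + 1), symLinKerAt (ctr (d + 1) Lc) Lc κ₀ x (l, z) * 𝓘₂ (fun k => lev (k + 1)) n H H' B l z)) :
    ∀ (n : ℕ) (lev : ℕ → ℕ) (M : Fin (d + 1) → ℕ) (H H' B : Form1 (d + 1) ℝ),
      (∀ (l : Fin (d + 1)) (w t : Site (d + 1)), H l (translate (towerTorus Lc M n) w t) = H l w) →
      (∀ (l : Fin (d + 1)) (w t : Site (d + 1)), H' l (translate (towerTorus Lc M n) w t) = H' l w) →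
      (∀ (l : Fin (d + 1)) (w t : Site (d + 1)), B l (translate (towerTorus Lc M n) w t) = B l w) →
      ∀ (l : Fin (d + 1)) (y t : Site (d + 1)), 𝓘₂ lev n H H' B l (translate M y t) = 𝓘₂ lev n H H' B l y := by
  intro n
  induction n with
  | zero => intro lev M H H' B _ _ _ l y t; rw [h0₂]; rfl
  | succ n IH =>
      intro lev M H H' B hH hH' hB l y t
      change ∀ (l : Fin (d + 1)) (w t : Site (d + 1)), H l (translate (towerTorus Lc (fine Lc M) n) w t) = H l w at hH
      change ∀ (l : Fin (d + 1)) (w t : Site (d + 1)), H' l (translate (towerTorus Lc (fine Lc M) n) w t) = H' l w at hH'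
      change ∀ (l : Fin (d + 1)) (w t : Site (d + 1)), B l (translate (towerTorus Lc (fine Lc M) n) w t) = B l w at hB
      have IH' := IH (fun k => lev (k + 1)) (fine Lc M) H H' B hH hH' hB
      have I1 := periodic_of_clauses Lc 𝓡 hR0 hRsucc 𝓘₁ h0₁ hsucc₁ n (fun k => lev (k + 1)) (fine Lc M) H B hH hB
      have I1' := periodic_of_clauses Lc 𝓡 hR0 hRsucc 𝓘₁ h0₁ hsucc₁ n (fun k => lev (k + 1)) (fine Lc M) H' B hH' hB
      have hRl : ∀ (F : Form1 (d + 1) ℝ), (∀ (l : Fin (d + 1)) (w t : Site (d + 1)), F l (translate (towerTorus Lc (fine Lc M) n) w t) = F l w) →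
          ∀ (l : Fin (d + 1)) (y m : Site (d + 1)), 𝓡 (fun k => lev (k + 1)) n F l (translate (fine Lc M) y m) = 𝓡 (fun k => lev (k + 1)) n F l y :=
        fun F hF => rows_periodic_of_clauses Lc 𝓡 hR0 hRsucc n (fun k => lev (k + 1)) (fine Lc M) F hF
      have htop := symVh2KerAt_form_translate Lc M (ctr (d + 1) Lc) (𝓡 (fun k => lev (k + 1)) n H) (𝓡 (fun k => lev (k + 1)) n H') (𝓡 (fun k => lev (k + 1)) n B)
        (hRl H hH) (hRl H' hH') (hRl B hB) l y t
      have hmix := symVhKerAt_form_translate Lc M (ctr (d + 1) Lc) (𝓡 (fun k => lev (k + 1)) n H) (𝓘₁ (fun k => lev (k + 1)) n H' B) (hRl H hH) I1' l y t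
      have hmix' := symVhKerAt_form_translate Lc M (ctr (d + 1) Lc) (𝓡 (fun k => lev (k + 1)) n H') (𝓘₁ (fun k => lev (k + 1)) n H B) (hRl H' hH') I1 l y t
      have hlow := symLinKerAt_form_translate Lc M (ctr (d + 1) Lc) _ IH' l y t
      rw [hsucc₂, hsucc₂, hlow, htop, hmix, hmix']

end Summit.QuantumFields.BalabanUV.Beta.FP.TorusCompositeInsertionPeriodicTwoSym

end
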